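import Summits.AtomisticToContinuum.BoseEinsteinCondensation.Theorems.BECDyadicChainingBaseCoherentMassBlockMassCapture
import Summits.AtomisticToContinuum.BoseEinsteinCondensation.Theorems.BECDyadicChainingCoherentAmplitudeMonotone
import HarnessLib

/-!
# Crux `DyadicCoherenceDefect` (stmt-AtomisticToContinuum-13192), line `registered` (lead c2 reshape):
# the registered-composition input K, `stub_blockKineticBound` (BLOCK KINETIC BOUND)

Supports (does not close) stmt-AtomisticToContinuum-13192. For every Dirichlet trial state `Ψ` of `N`
bosons in the box of side `L` and every dyadic level `k` (cube side `s = L/2^k`), with the flat modes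
`φ_{k,i} = s^{-3/2} 1_{C_i}` of the `8^k` OPEN dyadic cubes `C_i` and `T_k = Σ_i ⟨φ_{k,i}, γ_Ψ φ_{k,i}⟩`:

`N ≤ T_k + (s/π)² ∫ |∇Ψ|²`.

This is the kinetic (Neumann–Poincaré) engine of the line's window: combined with `T_{k+1} ≤ N`
(`stub_levelIncrement`) it bounds the Haar band `T_{k+1} − T_k ≤ N − T_k ≤ (s/π)² ∫|∇Ψ|²`, i.e. the
level-`k+1` increment of the block occupations costs at most `(2 s_{k+1}/π)² ×` kinetic energy.

Proof: BaseCoherentMass's landed `stub_blockMassCapture` (the same inequality over the HALF-OPEN dyadic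
cells `dyCell`, from the sharp Neumann gap `π²/s²` of each cube applied slice-wise in the first particle and
Bose symmetry, `key_inequality` of `BoseGasFreeDirichletBEC`), transported to the route's open cubes, which
are a.e. the half-open cells (`openCell_ae_eq_dyCell`, `occupation_congr_ae`). No new definitions.
-/

noncomputable section

namespace Summit.AtomisticToContinuum.BoseEinsteinCondensation.Cruxes.DyadicCoherenceDefect.Birth

open MeasureTheory
open scoped ENNReal NNReal BigOperators
open Literature.MathematicalPhysics.QuantumManyBody.BoseGas
open Summit.AtomisticToContinuum.BoseEinsteinCondensation.Theorems

/-- **K: block kinetic bound** (`BlockKineticBound` of the line `registered`). For every Dirichlet trial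
state `Ψ ∈ TrialState N L` and every level `k`, `N ≤ T_k + (L/(π 2^k))² ∫|∇Ψ|²`, where `T_k` is the total
occupation of the flat modes of the `8^k` open dyadic cubes of side `L/2^k` (sharp Neumann gap of each
cube, slice-wise, Bose symmetry; the open cubes are a.e. the half-open cells of `stub_blockMassCapture`).
[cite: LSSY2005, Ch. 5 (5.15)–(5.17)] -/
theorem stub_blockKineticBound :
    ∀ (N : ℕ) (L : ℝ) (Ψ : TrialState N L) (k : ℕ),
      let φ : (m : ℕ) → (Fin 3 → Fin (2 ^ m)) → EuclideanSpace ℝ (Fin 3) → ℂ := fun m i =>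
        Set.indicator {x : EuclideanSpace ℝ (Fin 3) | ∀ k : Fin 3, x k ∈
            Set.Ioo (((i k : ℕ) : ℝ) * (L / 2 ^ m)) ((((i k : ℕ) : ℝ) + 1) * (L / 2 ^ m))}
          (fun _ => ((Real.sqrt ((L / 2 ^ m) ^ 3))⁻¹ : ℂ))
      (N : ℝ≥0∞) ≤ (∑ i : Fin 3 → Fin (2 ^ k), occupation N (φ k i) Ψ.ψ) +
        ENNReal.ofReal ((L / 2 ^ k) ^ 2 / Real.pi ^ 2) * ∫⁻ X, kineticDensity Ψ.ψ X := by
  intro N L Ψ k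
  have h : ∀ i : Fin 3 → Fin (2 ^ k), occupation N (Set.indicator
      {x : EuclideanSpace ℝ (Fin 3) | ∀ j : Fin 3, x j ∈ Set.Ioo (((i j : ℕ) : ℝ) * (L / 2 ^ k))
        ((((i j : ℕ) : ℝ) + 1) * (L / 2 ^ k))}
      (fun _ => ((Real.sqrt ((L / 2 ^ k) ^ 3))⁻¹ : ℂ))) Ψ.ψ = occupation N (dyMode L k i) Ψ.ψ :=
    fun i => occupation_congr_ae (indicator_ae_eq_of_ae_eq_set
      (CoherentAmplitudeMonotone.openCell_ae_eq_dyCell L k i)) Ψ.ψ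
  simp only [h]
  exact BaseCoherentMass.stub_blockMassCapture N L Ψ k

end Summit.AtomisticToContinuum.BoseEinsteinCondensation.Cruxes.DyadicCoherenceDefect.Birth

end
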